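import Literature.NumberTheory.EllipticCurves.SingularModuliPrincipalPrimes
import Literature.NumberTheory.EllipticCurves.RingClassFieldInertiaGenerator
import Literature.NumberTheory.QuadraticFields.RingClassForms
import Literature.NumberTheory.QuadraticFields.IdealsOfPrimePowerNorm
import Literature.NumberTheory.NumberFields.RingClassFieldOfConductor
import Literature.NumberTheory.NumberFields.BauerSplitPrimes
import Literature.NumberTheory.GaloisRepresentations.ArtinReciprocityCharacterFiniteProofs
import Summits.BirchSwinnertonDyer.BirchSwinnertonDyer.Theorems.SylvesterTwoHeegnerIndexLevelFixingEtaEquiv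
import HarnessLib

/-!
# One Chebotarev prime and one Kronecker congruence: for `g ∈ Gal(K[c]/K)` there is a degree-one prime `u` of `K`
# with `Frob_u = g` (absolute Frobenius along the embedding `K[c] → K̄`) AND Hasse class `Φ(g) = [𝔞_u]^{±1}`,
# `𝔞_u` the form of the prime ideal `𝔭_u` (Deuring's argument, Cox §11.D (11.30)–(11.33))
# (crux `UpperOffV0HSYPlus`, stmt-BirchSwinnertonDyer-19804; route `SylvesterTwoHeegnerIndex`, rung K7t; (W2-b) route (4.2))

Cell `bsd-cm`, seat `bsd-cm-k7t-c2` g33 (PLAN Ω′ piece (II), STATUS 2026-08-29T23:36Z).  Helper toward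
`stmt-BirchSwinnertonDyer-19804` (`--supports … --as helper`).  THEOREMS ONLY (no definition, no named fact, no instance,
no `sorry`).

WHAT.  `K` imaginary quadratic with the ring-class-order data of `QuadraticFields/RingClassOrder.lean` (integral basis
`(1, b₁)`, `b₁² = m₀ + t₀ b₁`, `Δ.D = c² (t₀² + 4 m₀) = c² d_K`, `2s = Δ.D − c t₀`, `ιD : O_Δ → 𝓞 K`), `ι : K → ℂ`,
`L = K[c] = ringClassField K ι c ⊂ ℂ`, `e : L → K̄` a `K`-embedding, `Φ : Gal(L/K) ≃* Cl(𝒪_Δ)` an isomorphism with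
Hasse's translation law `s(j(κ)) = j(Φ(s)·κ)` (file (I), `exists_galClassEquiv_ringClassField`).

* §1 `intModularPolynomial_formJ_primeForm_principalForm` — the Hecke link behind Kronecker: for a primitive positive
  definite form `q = (ℓ, b, ·)` of discriminant `D` with `ℓ` prime, `Φ_ℓ(j(τ_q), j(τ_P)) = 0` (`P` the principal form):
  `τ_q = (τ_P + k)/ℓ` is a Hecke point of `τ_P` (`exists_kleinJ_eq_jConj_of_det` with the matrix `(1 k; 0 ℓ)`).
* §2 ★ `exists_frobenius_prime_galClass_eq_or_eq_inv` — for every `g ∈ Gal(L/K)` and every finite set `S` of primes of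
  `K` there is a prime `u ∉ S` of `K` of prime norm `ℓ = N u`, `u ∤ c`, unramified in the class field `e(L)`, together with
  (a) a prime `𝔓 ∣ u` of `\bar ℤ_K` and an ARITHMETIC FROBENIUS `F ∈ Γ_K` at `𝔓` inducing `g` on `L`
  (`F • e x = e (g x)`), and (b) the primitive positive definite form `q_u = (ℓ, β, ·)` of discriminant `Δ.D` whose ideal is
  `𝔭_u` (`(fIdeal Δ q_u).map ιD = u.asIdeal`, `RingClassPrimeForms`), such that **`Φ(g) = [q_u]` or `Φ(g) = [q_u]⁻¹`**.
  Proof: Chebotarev on the class field `R = e(L) ⊆ K̄` (`infinite_setOf_exists_isArithFrobAt`); Deuring's dichotomy with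
  a prescribed Frobenius (`exists_kronecker_dichotomy_modulus_of_frobenius`, `kronecker_congruence_int`) on the finite
  `Aut(R/ℚ)`-stable set `{j(κ)}` and §1; `classJ_injective`.  (a): any Frobenius `F` at any `𝔓 ∣ u` restricts to a
  Frobenius of `R` (`isArithFrobAt_absRestrictNormalHom`), hence to `g_R` (`eq_of_isArithFrobAt_of_commute`).
USE: with `g := ψ = Φ⁻¹(η*)` this names ONE good prime `u₂` with `[q_{u₂}] = η*` and `Frob_{u₂} = ψ` (sequel (IV)).
HONEST LABEL: generic CM/CFT bookkeeping; no stub closed; nothing asserted on 19804; X12.CMAtTwo NOT proved; BSD is proved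
for no curve.

## References
* D. A. Cox, *Primes of the form x² + ny²*, 2nd ed. (2013), §7.B Thm. 7.7, §7.C Prop. 7.20/7.22, §11.B (11.12)–(11.15),
  §11.C Thm. 11.18 (v), §11.D proof of Thm. 11.1 (11.30)–(11.33). [Cox2013]
* J. Neukirch, *Algebraic Number Theory* (1999), Ch. VII §13 Thm. (13.4). [NeukirchANT1999]
* H. Darmon, CBMS 101 (2004), Thm. 3.3, 3.7. [Darmon2004]
-/

set_option autoImplicit false
-- the Summit-side namespace `Summit.BirchSwinnertonDyer.BirchSwinnertonDyer.…` (summit = problem) is mandated by D-0017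
set_option linter.dupNamespace false

noncomputable section

open scoped Classical Cardinal MatrixGroups QuadraticAlgebra

namespace Summit.BirchSwinnertonDyer.BirchSwinnertonDyer.Theorems.SylvesterTwoLevelFixingKronecker

open Polynomial NumberField Field IsDedekindDomain IsDedekindDomain.HeightOneSpectrum Module UpperHalfPlane
  Literature.NumberTheory.EllipticCurves Literature.NumberTheory.EllipticCurves.ModularForms
  Literature.NumberTheory.QuadraticFields.BinaryQuadraticForm Literature.NumberTheory.QuadraticFields.Quadratic
  Literature.NumberTheory.QuadraticFields.RingClass
  Literature.Computability.Cryptography.Hallgren2005 Literature.Computability.Cryptography.Hallgren2005.OrderCl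
  Literature.NumberTheory.ComplexMultiplication.CMTypeLattice
  Literature.NumberTheory.GaloisRepresentations Literature.NumberTheory.NumberFields
  Literature.NumberTheory.NumberFields.RingClassField
  Summit.BirchSwinnertonDyer.BirchSwinnertonDyer.Theorems.SylvesterTwoLevelFixingEta

/-! ## §0 Cox Thm. 7.7 for a degree-one prime: `𝔭_v = 𝔞_q 𝓞_K` with `q = (p, β, ·)` -/

section PrimeForm

variable {K : Type} [Field K] [NumberField K]

omit [NumberField K] in
/-- `(p, f·x) = (p, x)` as ideals when `gcd(p, f) = 1`. [folklore] -/
theorem span_pair_natCast_mul_eq_of_coprime' {R : Type*} [CommRing R] {p f : ℕ} (h : Nat.Coprime p f)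
    (x : R) : Ideal.span {(p : R), (f : R) * x} = Ideal.span {(p : R), x} := by
  apply le_antisymm
  · rw [Ideal.span_le]
    rintro y hy
    simp only [Set.mem_insert_iff, Set.mem_singleton_iff] at hy
    rcases hy with rfl | rfl
    · exact Ideal.subset_span (by simp)
    · exact Ideal.mul_mem_left _ _ (Ideal.subset_span (by simp))
  · rw [Ideal.span_le]
    rintro y hy
    simp only [Set.mem_insert_iff, Set.mem_singleton_iff] at hy
    rcases hy with rfl | rfl
    · exact Ideal.subset_span (by simp)
    · obtain ⟨u, w, huw⟩ := Nat.isCoprime_iff_coprime.mpr h.symm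
      rw [SetLike.mem_coe, Ideal.mem_span_pair]
      refine ⟨(w : R) * y, (u : R), ?_⟩
      have hcast : ((u * (f : ℤ) + w * (p : ℤ) : ℤ) : R) = 1 := by rw [huw]; simp
      push_cast at hcast
      linear_combination y * hcast

/-- **A degree-one prime `𝔭 ∤ f` is the ideal of a form `(p, β, ·)`** (Cox, Thm. 7.7 with Prop. 7.20; the tree's
`RingClass.exists_form_map_fIdeal_eq_of_absNorm_prime` — re-derived verbatim here because that Literature module is not in
the build closure served to this file): for a prime `v` of `𝓞 K` with `v ∤ f𝓞_K` and `N v = p` prime there is a primitive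
positive definite form `q = (p, 2k − D, C)` of discriminant `D = f² d_K`, `gcd(p, f) = 1`, with `𝔞_q 𝓞_K = 𝔭_v`.
[cite: Cox2013, §7.B Thm. 7.7 and §7.C Prop. 7.20] -/
theorem exists_primeForm_map_fIdeal_eq (b : Basis (Fin 2) ℤ (𝓞 K)) (hb : b 0 = 1) {t m : ℤ}
    (hω : b 1 * b 1 = (m : 𝓞 K) + (t : 𝓞 K) * b 1) {f : ℕ} {Δ : NegDiscr} {s : ℤ}
    (hD : Δ.D = (f : ℤ) ^ 2 * (t ^ 2 + 4 * m)) (hs : 2 * s = Δ.D - f * t)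
    (ι : QO Δ →+* 𝓞 K) (hι : ι ω = (f : 𝓞 K) * b 1 + (s : 𝓞 K))
    (v : HeightOneSpectrum (𝓞 K)) (hv : ¬ Ideal.span {(f : 𝓞 K)} ≤ v.asIdeal)
    (hp : (Ideal.absNorm v.asIdeal).Prime) :
    ∃ q : BinQF, q.IsPosPrim Δ.D ∧ q.a = (Ideal.absNorm v.asIdeal : ℤ) ∧ IsCoprime q.a (f : ℤ) ∧
      (fIdeal Δ q).map ι = v.asIdeal := by
  set p : ℕ := Ideal.absNorm v.asIdeal with hpdef
  obtain ⟨k₀, C₀, hn₀, hveq⟩ := exists_eq_span_pair_of_absNorm_eq_prime b hb hω hp hpdef.symm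
  have hpf : Nat.Coprime p f := by
    rw [Nat.Prime.coprime_iff_not_dvd hp]
    rintro ⟨c, hc⟩
    apply hv
    rw [Ideal.span_singleton_le_iff_mem, hc, Nat.cast_mul]
    exact Ideal.mul_mem_right _ _ (Ideal.absNorm_mem v.asIdeal)
  have hcopZ : IsCoprime (p : ℤ) (f : ℤ) := Nat.isCoprime_iff_coprime.mpr hpf
  have hsq := sq_add_eq hD hs
  set k : ℤ := f * k₀ + s with hk
  set C : ℤ := (f : ℤ) ^ 2 * C₀ with hC
  have hAC : (p : ℤ) * C = k ^ 2 - Δ.D * k - FormComposition.mOf Δ.D := by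
    rw [hk, hC]
    linear_combination (f : ℤ) ^ 2 * hn₀ - (f : ℤ) * k₀ * hs - hsq
  obtain ⟨hdisc, hkq⟩ := disc_mk_eq (A := (p : ℤ)) (C := C) hD hAC
  have hprim := isPrimitive_of_isCoprime b hb hD ι hι hAC hcopZ
  set q : BinQF := ⟨p, 2 * k - Δ.D, C⟩ with hqdef
  have hq : q.IsPosPrim Δ.D := ⟨hdisc, by simp only [q]; exact_mod_cast hp.pos, hprim⟩
  refine ⟨q, hq, rfl, hcopZ, ?_⟩
  rw [fIdeal, hkq, Ideal.map_span, Set.image_pair, map_sub, map_intCast, map_intCast, hι]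
  have hgen : (f : 𝓞 K) * b 1 + (s : 𝓞 K) - ((k : ℤ) : 𝓞 K) = (f : 𝓞 K) * (b 1 - ((k₀ : ℤ) : 𝓞 K)) := by
    rw [hk]; push_cast; ring
  have hqa : ((q.a : ℤ) : 𝓞 K) = ((p : ℕ) : 𝓞 K) := by simp [q]
  rw [hgen, hqa, span_pair_natCast_mul_eq_of_coprime' hpf, hveq, Int.cast_natCast]

end PrimeForm

/-! ## §1 The Hecke link `Φ_ℓ(j(τ_q), j(τ_P)) = 0` for a form `q = (ℓ, β, ·)` -/

/-- **`Φ_ℓ(j(τ_q), j(τ_P)) = 0`**: for a primitive positive definite form `q = (ℓ, b, c)` of discriminant `D < 0`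
(`D ≡ 0, 1 (mod 4)`) with `ℓ` prime and `P = principalForm D = (1, b₀, c₀)`, the point `τ_q = (−b + √D)/(2ℓ) =
(τ_P + k)/ℓ` (`2k = b₀ − b`) is a Hecke `ℓ`-neighbour of `τ_P`, so `j(τ_q)` is a root of `Φ_ℓ(X, j(τ_P))`
(Cox §11.B: the matrix `(1 k; 0 ℓ)` of determinant `ℓ`; `exists_kleinJ_eq_jConj_of_det`). [cite: Cox2013, §11.B (11.12)–(11.15) and §11.D (11.30)] -/
theorem intModularPolynomial_formJ_primeForm_principalForm {D : ℤ} (hD : D < 0) (hD4 : D % 4 = 0 ∨ D % 4 = 1)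
    {ℓ : ℕ} [Fact ℓ.Prime] {q : BinQF} (hq : q.IsPosPrim D) (hqa : q.a = (ℓ : ℤ)) :
    (((intModularPolynomial ℓ).map (mapRingHom (Int.castRingHom ℂ))).map
      (evalRingHom (formJ (principalForm D)))).eval (formJ (q.a, q.b, q.c)) = 0 := by
  rw [map_intModularPolynomial, formJ_eq_kleinJ, formJ_eq_kleinJ]
  obtain ⟨hdP, hAP, -, -⟩ := (mem_reducedForms_iff hD).1 (principalForm_mem_reducedForms hD hD4)
  set P := principalForm D with hPdef
  set τ₁ := heegnerTau P with hτ₁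
  -- parity: `b ≡ b₀ (mod 2)`
  have hdq : q.b ^ 2 - 4 * q.a * q.c = D := by have := hq.disc_eq; rw [BinQF.disc] at this; exact this
  have hdP' : P.2.1 ^ 2 - 4 * P.1 * P.2.2 = D := hdP
  obtain ⟨k, hk⟩ : ∃ k : ℤ, P.2.1 = q.b + 2 * k := by
    have h2 : (2 : ℤ) ∣ P.2.1 - q.b := by
      have h4 : (2 : ℤ) ∣ (P.2.1 - q.b) * (P.2.1 + q.b) := by
        have : (P.2.1 - q.b) * (P.2.1 + q.b) = 2 * (2 * P.1 * P.2.2 - 2 * q.a * q.c) := by nlinarith [hdq, hdP']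
        rw [this]; exact dvd_mul_right 2 _
      rcases (Int.prime_two.dvd_or_dvd h4) with h | h
      · exact h
      · have : P.2.1 - q.b = (P.2.1 + q.b) - 2 * q.b := by ring
        rw [this]; exact dvd_sub h (dvd_mul_right 2 _)
    obtain ⟨k, hk⟩ := h2
    exact ⟨k, by linarith⟩
  -- the matrix `(1 k; 0 ℓ)` of determinant `ℓ`
  let M : Matrix (Fin 2) (Fin 2) ℤ := !![1, k; 0, (ℓ : ℤ)]
  have hM : M.det = (ℓ : ℤ) := by rw [Matrix.det_fin_two_of]; ring
  obtain ⟨w, hw, i, hi⟩ := exists_kleinJ_eq_jConj_of_det (p := ℓ) ⟨M, hM⟩ τ₁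
  rw [show (⟨M, hM⟩ : FixedDetMatrix (Fin 2) ℤ (ℓ : ℤ)).1 0 0 = 1 from rfl,
    show (⟨M, hM⟩ : FixedDetMatrix (Fin 2) ℤ (ℓ : ℤ)).1 0 1 = k from rfl,
    show (⟨M, hM⟩ : FixedDetMatrix (Fin 2) ℤ (ℓ : ℤ)).1 1 0 = 0 from rfl,
    show (⟨M, hM⟩ : FixedDetMatrix (Fin 2) ℤ (ℓ : ℤ)).1 1 1 = (ℓ : ℤ) from rfl] at hw
  push_cast at hw
  rw [zero_mul, zero_add, one_mul] at hw
  -- `w = τ_q`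
  have hℓ0 : (ℓ : ℂ) ≠ 0 := by exact_mod_cast (Fact.out : ℓ.Prime).ne_zero
  have hq1 : 0 < (q.a, q.b, q.c).1 := hq.a_pos
  have hsq : sqrtDisc D = 2 * ((q.a : ℤ) : ℂ) * (heegnerTau (q.a, q.b, q.c) : ℂ) + ((q.b : ℤ) : ℂ) :=
    sqrtDisc_eq (Q := (q.a, q.b, q.c)) hq1 hdq hD
  have hsP : sqrtDisc D = 2 * ((P.1 : ℤ) : ℂ) * (τ₁ : ℂ) + ((P.2.1 : ℤ) : ℂ) := sqrtDisc_eq (Q := P) hAP hdP' hD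
  have haℓ : ((q.a : ℤ) : ℂ) = (ℓ : ℂ) := by rw [hqa]; push_cast; rfl
  have hP1 : ((P.1 : ℤ) : ℂ) = 1 := by rw [show P.1 = 1 from principalForm_fst D]; push_cast; rfl
  have hPb : ((P.2.1 : ℤ) : ℂ) = (q.b : ℂ) + 2 * (k : ℂ) := by rw [hk]; push_cast; rfl
  rw [haℓ] at hsq
  rw [hP1, hPb] at hsP
  have hwτ : (w : ℂ) = heegnerTau (q.a, q.b, q.c) := by
    have h1 : (w : ℂ) * ℓ = τ₁ + k := hw
    have h2 := hsP.symm.trans hsq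
    apply mul_right_cancel₀ hℓ0
    rw [h1]
    linear_combination (1 / 2 : ℂ) * h2
  have hw' : w = heegnerTau (q.a, q.b, q.c) := UpperHalfPlane.ext hwτ
  rw [eval_map_kleinJ_modularPolynomial, Finset.prod_eq_zero (Finset.mem_univ i)]
  rw [← hi, hw', sub_self]

/-! ## §2 ★ One Chebotarev prime with its Kronecker reading -/

variable {K : Type} [Field K] [NumberField K]

/-- `j(κ)` is the `j`-invariant of a reduced form of discriminant `Δ.D`. [cite: Cox2013, §7.B Thm. 7.7 and §11.A Thm. 11.1] -/
theorem classJ_mem_image_formJ (Δ : NegDiscr) (hD4 : Δ.D % 4 = 0 ∨ Δ.D % 4 = 1) (κ : ClassGroup (QO Δ)) :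
    classJ Δ κ ∈ (reducedForms Δ.D).image formJ := by
  obtain ⟨g, hg, hred, rfl⟩ := exists_isReduced_classOf'_eq_of_emod_four Δ hD4 κ
  rw [classJ_classOf' hg]
  exact Finset.mem_image.mpr ⟨(g.a, g.b, g.c), mem_reducedForms_of_isPosPrim_of_isReduced Δ.neg hg hred, rfl⟩

/-- A `j`-invariant of a reduced form of discriminant `Δ.D` is some `j(κ)`. [cite: Cox2013, §7.B Thm. 7.7 and §11.A Thm. 11.1] -/
theorem exists_classJ_eq_of_mem_image_formJ (Δ : NegDiscr) {x : ℂ} (hx : x ∈ (reducedForms Δ.D).image formJ) :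
    ∃ κ : ClassGroup (QO Δ), x = classJ Δ κ := by
  obtain ⟨Q, hQ, rfl⟩ := Finset.mem_image.mp hx
  obtain ⟨hQpp, -⟩ := isPosPrim_and_isReduced_of_mem_reducedForms Δ.neg hQ
  exact ⟨classOf' Δ ⟨Q.1, Q.2.1, Q.2.2⟩, (classJ_classOf'_triple hQpp).symm⟩

set_option maxHeartbeats 800000 in
/-- ★ **ONE CHEBOTAREV PRIME WITH ITS KRONECKER READING.**  `K` imaginary quadratic with ring-class-order data
`(b, hb, hω, hD, hs, ιD, hιD)` at conductor `c ≠ 0` (`Δ.D = c² d_K`), `ι : K → ℂ`, `L = K[c] ⊂ ℂ`, `e : L → K̄` over `K`,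
`Φ : Gal(L/K) ≃* Cl(𝒪_Δ)` with the translation law `hΦ`.  For every `g ∈ Gal(L/K)` and every finite set `S` of primes of
`K` there are: a prime `u ∉ S` of `K` with `N u = ℓ` prime and `u ∤ c`; a prime `𝔓 ∣ u` of `\bar ℤ_K` and an arithmetic
Frobenius `F ∈ Γ_K` at `𝔓` with `F • e(x) = e(g x)` for all `x ∈ L`; and a primitive positive definite form `q` of
discriminant `Δ.D` with `q.a = ℓ`, `gcd(ℓ, c) = 1`, `𝔞_q 𝓞_K = 𝔭_u`, such that `Φ g = [q]` or `Φ g = [q]⁻¹`.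
[cite: Cox2013, §11.D proof of Thm. 11.1 (11.30)–(11.33), §11.C Thm. 11.18 (v), §7.B Thm. 7.7]
[cite: NeukirchANT1999, Ch. VII §13 Thm. (13.4)] [cite: Darmon2004, Thm. 3.7] -/
theorem exists_frobenius_prime_galClass_eq_or_eq_inv (hK : IsImaginaryQuadratic K) (ι : K →+* ℂ)
    {c : ℕ} (hc : c ≠ 0) (Δ : NegDiscr) (hΔ : Δ.D = (c : ℤ) ^ 2 * NumberField.discr K)
    -- ring-class-order data (Cox §7: `O_Δ ↪ 𝓞 K`)
    (b : Basis (Fin 2) ℤ (𝓞 K)) (hb : b 0 = 1) {t₀ m₀ : ℤ} (hω : b 1 * b 1 = (m₀ : 𝓞 K) + (t₀ : 𝓞 K) * b 1)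
    {s : ℤ} (hD : Δ.D = (c : ℤ) ^ 2 * (t₀ ^ 2 + 4 * m₀)) (hs : 2 * s = Δ.D - c * t₀)
    (ιD : QO Δ →+* 𝓞 K) (hιD : ιD ω = (c : 𝓞 K) * b 1 + (s : 𝓞 K))
    -- Hasse's `Φ`
    (Φ : (ringClassField K ι c ≃ₐ[K] ringClassField K ι c) ≃* ClassGroup (QO Δ))
    (hΦ : ∀ (s : ringClassField K ι c ≃ₐ[K] ringClassField K ι c) (κ : ClassGroup (QO Δ)),
      ((s ⟨classJ Δ κ, classJ_mem_ringClassField hK ι Δ hΔ κ⟩ : ringClassField K ι c) : ℂ) = classJ Δ (Φ s * κ))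
    -- the embedding into `K̄`
    (e : ringClassField K ι c →+* AlgebraicClosure K)
    (he : ∀ k : K, e (algebraMap K (ringClassField K ι c) k) = algebraMap K (AlgebraicClosure K) k)
    (g : ringClassField K ι c ≃ₐ[K] ringClassField K ι c)
    {S : Set (HeightOneSpectrum (𝓞 K))} (hS : S.Finite) :
    ∃ u : HeightOneSpectrum (𝓞 K), u ∉ S ∧ (Ideal.absNorm u.asIdeal).Prime ∧
      ¬ Ideal.span {(c : 𝓞 K)} ≤ u.asIdeal ∧
      (∃ 𝔓 ∈ u.primesAbove, ∃ F : absoluteGaloisGroup K, IsArithFrobAt (𝓞 K) F 𝔓 ∧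
        ∀ x : ringClassField K ι c, F • (e x) = e (g x)) ∧
      ∃ q : BinQF, q.IsPosPrim Δ.D ∧ q.a = (Ideal.absNorm u.asIdeal : ℤ) ∧ IsCoprime q.a (c : ℤ) ∧
        (fIdeal Δ q).map ιD = u.asIdeal ∧ (Φ g = classOf' Δ q ∨ Φ g = (classOf' Δ q)⁻¹) := by
  have hD4 := sq_mul_discr_emod_four hK Δ hΔ
  haveI := (finiteDimensional_and_isGalois_ringClassField hK ι hc).1
  haveI := (finiteDimensional_and_isGalois_ringClassField hK ι hc).2
  -- ### the class field `R = e(L) ⊆ K̄` and the transported automorphism `gR`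
  let φe : ringClassField K ι c →ₐ[K] AlgebraicClosure K := AlgHom.mk e he
  have hφe : ∀ x, φe x = e x := fun _ ↦ rfl
  have hR := fieldRange_emb_ringClassField_eq hK ι hc e he
  let R : IntermediateField K (AlgebraicClosure K) := φe.fieldRange
  have hRdef : R = φe.fieldRange := rfl
  let eR : ringClassField K ι c ≃ₐ[K] R := AlgEquiv.ofInjectiveField φe
  have heR : ∀ x, ((eR x : R) : AlgebraicClosure K) = e x := fun x ↦
    AlgEquiv.ofInjective_apply φe φe.toRingHom.injective x
  haveI : FiniteDimensional K R := by rw [hRdef, hR]; infer_instance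
  haveI : IsGalois K R := by rw [hRdef, hR]; infer_instance
  haveI : NumberField R := by rw [hRdef, hR]; infer_instance
  let gR : R ≃ₐ[K] R := eR.symm.trans (g.trans eR)
  have hgR : ∀ x : ringClassField K ι c, gR (eR x) = eR (g x) := fun x ↦ by
    change eR (g (eR.symm (eR x))) = eR (g x); rw [AlgEquiv.symm_apply_apply]
  -- `Gal(R/K)` is commutative (it is `Gal(L/K) ≅ Cl`)
  have hcommL : ∀ a a' : ringClassField K ι c ≃ₐ[K] ringClassField K ι c, Commute a a' := fun a a' ↦ by
    apply Φ.injective; rw [map_mul, map_mul, mul_comm]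
  have hcomm : ∀ a a' : R ≃ₐ[K] R, Commute a a' := by
    intro a a'
    have h := hcommL (eR.trans (a.trans eR.symm)) (eR.trans (a'.trans eR.symm))
    apply AlgEquiv.ext; intro y
    have hy := congrArg (fun f : ringClassField K ι c ≃ₐ[K] ringClassField K ι c ↦ eR (f (eR.symm y))) h.eq
    simpa [AlgEquiv.mul_apply] using hy
  -- ### the finite `Aut(R/ℚ)`-stable set of singular moduli, transported to `R`
  haveI : Finite (ClassGroup (QO Δ)) := finite_classGroup_QO_of_emod_four Δ hD4
  letI : Fintype (ClassGroup (QO Δ)) := Fintype.ofFinite _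
  let jL : ClassGroup (QO Δ) → ringClassField K ι c := fun κ ↦ ⟨classJ Δ κ, classJ_mem_ringClassField hK ι Δ hΔ κ⟩
  have hjL : ∀ κ, ((jL κ : ringClassField K ι c) : ℂ) = classJ Δ κ := fun _ ↦ rfl
  let eC : R →+* ℂ :=
    (ringClassField K ι c).subtype.comp (eR.symm : R ≃ₐ[K] ringClassField K ι c).toRingEquiv.toRingHom
  have heC : ∀ x : ringClassField K ι c, eC (eR x) = (x : ℂ) := fun x ↦ by
    change ((eR.symm (eR x) : ringClassField K ι c) : ℂ) = x; rw [AlgEquiv.symm_apply_apply]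
  have heCinj : Function.Injective eC := eC.injective
  set T : Finset R := Finset.univ.image (fun κ ↦ eR (jL κ)) with hTdef
  have hmemT : ∀ κ, eR (jL κ) ∈ T := fun κ ↦ Finset.mem_image.mpr ⟨κ, Finset.mem_univ _, rfl⟩
  have hT : ∀ σ : R ≃ₐ[ℚ] R, ∀ t ∈ T, σ t ∈ T := by
    intro σ t ht
    obtain ⟨κ, -, rfl⟩ := Finset.mem_image.mp ht
    have h1 : eC (eR (jL κ)) ∈ (reducedForms Δ.D).image formJ := by
      rw [heC, hjL]; exact classJ_mem_image_formJ Δ hD4 κ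
    have h2 := apply_mem_image_formJ_of_mem Δ.neg eC σ h1
    obtain ⟨κ', hκ'⟩ := exists_classJ_eq_of_mem_image_formJ Δ h2
    have h3 : σ (eR (jL κ)) = eR (jL κ') := heCinj (by rw [hκ', heC, hjL])
    rw [h3]; exact hmemT κ'
  -- ### Deuring's modulus `N`, and the enlarged finite set of primes to avoid
  obtain ⟨N, hN0, hdich⟩ := exists_kronecker_dichotomy_modulus_of_frobenius T hT
  have hcN : Ideal.span {((c * N : ℕ) : 𝓞 K)} ≠ ⊥ := by
    rw [Ne, Ideal.span_singleton_eq_bot]; exact_mod_cast mul_ne_zero hc hN0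
  set S' : Set (HeightOneSpectrum (𝓞 K)) := S ∪ {v | Ideal.span {((c * N : ℕ) : 𝓞 K)} ≤ v.asIdeal} with hS'
  have hS'fin : S'.Finite := hS.union (finite_setOf_le_asIdeal hcN)
  -- ### Chebotarev on `R`
  obtain ⟨u, ⟨hprime, hunr, Q, hQ, hfrob⟩, huS'⟩ :=
    ((infinite_setOf_exists_isArithFrobAt (F := K) (L := R) gR).sdiff hS'fin).nonempty
  have huS : u ∉ S := fun h ↦ huS' (Or.inl h)
  set ℓ : ℕ := Ideal.absNorm u.asIdeal with hℓdef
  haveI : Fact ℓ.Prime := ⟨hprime⟩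
  have hℓu : (ℓ : 𝓞 K) ∈ u.asIdeal := Ideal.absNorm_mem u.asIdeal
  have hcNu : ¬ Ideal.span {((c * N : ℕ) : 𝓞 K)} ≤ u.asIdeal := fun h ↦ huS' (Or.inr h)
  have hcu : ¬ Ideal.span {(c : 𝓞 K)} ≤ u.asIdeal := by
    intro h; apply hcNu
    rw [Ideal.span_singleton_le_iff_mem] at h ⊢
    rw [Nat.cast_mul]; exact Ideal.mul_mem_right _ _ h
  have hℓN : ¬ ℓ ∣ N := by
    rintro ⟨k, hk⟩; apply hcNu
    rw [Ideal.span_singleton_le_iff_mem, hk]; push_cast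
    have : (c : 𝓞 K) * ((ℓ : 𝓞 K) * (k : 𝓞 K)) = (c * k : 𝓞 K) * (ℓ : 𝓞 K) := by ring
    rw [this]; exact Ideal.mul_mem_left _ _ hℓu
  -- ### the form `q_u` of `𝔭_u`
  obtain ⟨q, hq, hqa, hqcop, hqmap⟩ :=
    exists_primeForm_map_fIdeal_eq b hb hω hD hs ιD hιD u hcu hprime
  -- ### (a) an absolute Frobenius `F` at some `𝔓 ∣ u` induces `g`
  obtain ⟨𝔓, h𝔓⟩ := u.primesAbove_nonempty
  obtain ⟨F, hF⟩ := HeightOneSpectrum.exists_isArithFrobAt_of_mem_primesAbove_holds (v := u) h𝔓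
  haveI : 𝔓.IsPrime := h𝔓.1
  have hQ' := comap_ringOfIntegersToIntegralClosure_mem_primesOver_of_mem_primesAbove R h𝔓
  have hF' := isArithFrobAt_absRestrictNormalHom R hF
  have hgF : gR = absRestrictNormalHom R F :=
    eq_of_isArithFrobAt_of_commute hunr hcomm hQ' hQ hF' hfrob
  have hres : ∀ y : R, ((absRestrictNormalHom R F y : R) : AlgebraicClosure K) = F • (y : AlgebraicClosure K) :=
    fun y ↦ AlgEquiv.restrictNormalHom_apply _ _ y
  have hFe : ∀ x : ringClassField K ι c, F • (e x) = e (g x) := fun x ↦ by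
    rw [← heR x, ← hres, ← hgF, hgR, heR]
  -- ### (b) Kronecker at `u`: `Φ g ∈ {[q], [q]⁻¹}`
  refine ⟨u, huS, hprime, hcu, ⟨𝔓, h𝔓, F, hF, hFe⟩, q, hq, hqa, hqcop, hqmap, ?_⟩
  -- the two singular moduli `t = j(1)`, `t' = j([q])` in `R`, with `Φ_ℓ(t', t) = 0`
  set κq : ClassGroup (QO Δ) := classOf' Δ q with hκq
  have hQne : Q ≠ ⊥ := by
    intro hQ0
    have h1 : algebraMap (𝓞 K) (𝓞 R) (ℓ : 𝓞 K) ∈ Q := by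
      have hov : Q.under (𝓞 K) = u.asIdeal := hQ.2.over.symm
      have : (ℓ : 𝓞 K) ∈ Q.under (𝓞 K) := by rw [hov]; exact hℓu
      exact Ideal.mem_comap.mp this
    rw [hQ0, Ideal.mem_bot, map_natCast, Nat.cast_eq_zero] at h1
    exact (Fact.out : ℓ.Prime).ne_zero h1
  haveI : Q.IsPrime := hQ.1
  have hQmax : Q.IsMaximal := Ideal.IsPrime.isMaximal inferInstance hQne
  have hℓQ : (ℓ : 𝓞 R) ∈ Q := by
    have hov : Q.under (𝓞 K) = u.asIdeal := hQ.2.over.symm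
    have : (ℓ : 𝓞 K) ∈ Q.under (𝓞 K) := by rw [hov]; exact hℓu
    have h := Ideal.mem_comap.mp this
    rwa [map_natCast] at h
  have hcardK : Nat.card (𝓞 K ⧸ Q.under (𝓞 K)) = ℓ := by
    rw [← hQ.2.over, ← Submodule.cardQuot_apply, ← Ideal.absNorm_apply]
  have hσ : ∀ x : 𝓞 R, (gR.restrictScalars ℚ) • x - x ^ ℓ ∈ Q := by
    intro x
    have h := hfrob x
    rw [hcardK, MulSemiringAction.toAlgHom_apply] at h
    have e1 : (gR.restrictScalars ℚ) • x = gR • x := Subtype.ext rfl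
    rw [e1]; exact h
  have hFpoly : (intModularPolynomial ℓ).map (mapRingHom (Int.castRingHom (ZMod ℓ))) =
      (X ^ ℓ - C X) * (X - C (X ^ ℓ)) := by
    rw [kronecker_congruence_int]; rfl
  have hqa' : q.a = ((ℓ : ℕ) : ℤ) := hqa
  have hlinkC : (((intModularPolynomial ℓ).map (mapRingHom (Int.castRingHom ℂ))).map
      (evalRingHom (classJ Δ 1))).eval (classJ Δ κq) = 0 := by
    rw [classJ_one Δ hD4, hκq, classJ_classOf' hq]
    exact intModularPolynomial_formJ_primeForm_principalForm Δ.neg hD4 hq hqa'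
  have hlinkR : (((intModularPolynomial ℓ).map (mapRingHom (Int.castRingHom R))).map
      (evalRingHom (eR (jL 1)))).eval (eR (jL κq)) = 0 := by
    apply heCinj
    rw [map_eval_map_map_int eC, map_zero, heC, heC, hjL, hjL]
    exact hlinkC
  have hdich' := hdich ℓ hprime hℓN Q hQmax hℓQ (gR.restrictScalars ℚ) hσ (intModularPolynomial ℓ) hFpoly
    (eR (jL 1)) (hmemT 1) (eR (jL κq)) (hmemT κq) hlinkR
  -- reading the dichotomy through `Φ`
  have hgj : ∀ κ, (gR.restrictScalars ℚ) (eR (jL κ)) = eR (jL (Φ g * κ)) := by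
    intro κ
    change gR (eR (jL κ)) = eR (jL (Φ g * κ))
    rw [hgR]
    congr 1
    apply Subtype.ext
    exact hΦ g κ
  have hjinj : ∀ κ κ', eR (jL κ) = eR (jL κ') → κ = κ' := fun κ κ' h ↦ by
    apply classJ_injective hD4
    have h' := congrArg (fun y : R ↦ eC y) h
    simpa only [heC, hjL] using h'
  rcases hdich' with h1 | h1
  · -- `j([q]) = g(j(1)) = j(Φ g)`
    left
    rw [hgj 1, mul_one] at h1
    exact (hjinj _ _ h1).symm
  · -- `j(1) = g(j([q])) = j(Φ g · [q])`
    right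
    rw [hgj κq] at h1
    have h2 : (1 : ClassGroup (QO Δ)) = Φ g * κq := hjinj _ _ h1
    rw [eq_inv_iff_mul_eq_one, ← h2]

end Summit.BirchSwinnertonDyer.BirchSwinnertonDyer.Theorems.SylvesterTwoLevelFixingKronecker

end
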